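import Literature.Probability.LatticeModels.ScaleFrameRatioChain
import HarnessLib

/-!
# Kesten's ratio forgetting along a scale frame: the chain kernel has bounded cross-ratios (proved,
modulo Kesten's Lemma (23))

Topic `Literature/Probability/LatticeModels` (trunk `StatMech`, family `crit-ising`). The kernel of
one level of the chain (`ScaleFrameRatioChain.lean`) between an outer datum `C = (U_C, R_C)` of the
block `(b', b'M^m)`, `b' = bM^{m+17+g}`, and an inner datum `D = (U_D, R_D)` of the block `(b, bM^m)`,

  `N(C, D) = φ(Fd_{b'}(C) ∩ Fd_b(D) ∩ {R_D ↔ R_C inside (U_C ∪ R_C) ∖ U_D})`,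

is the kernel of Kesten's Lemma (23) (H. Kesten, PTRF 73 (1986), §2; D. Basu, A. Sapozhnikov,
ECP 22 (2017), eq. (2.9)) for the inner datum `D` in the outer CONTEXT
`(Fo, Wo, R) = (Fd_{b'}(C), U_C ∪ R_C, R_C)`. Here we check that every outer datum with nonempty
event is an admissible context (`Fd_{b'}(C)` is read on the edges touching the outer block, all of
whose endpoints lie beyond scale `bM^{m+16+g}`; `U_C ⊇ inSet b'`; `R_C` lies beyond `b'M^m`) and
every inner datum with nonempty event is admissible (`U_D ⊆ {rad < bM^m}`, `R_D ⊆ {rad < bM^m + η}`),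
so that Lemma (23), taken as a hypothesis in the exact form of the registered statement
`ScaleFrame.kernel_crossRatio_le`, bounds the cross-ratios of `N`:
`N(C, D) N(C', D') ≤ (q⁸/c²⁰) N(C, D') N(C', D)` (`ScaleFrame.kernel_crossRatio_le_of_key`; empty
datum events contribute vanishing kernels). Everything is proved; no definitions.

## References
* [Kesten1986] H. Kesten, Probab. Theory Related Fields 73 (1986) 369–394, §2, Lemma (23).
* [BasuSapozhnikov2017ECP] D. Basu, A. Sapozhnikov, ECP 22 (2017) no. 26, §2, eq. (2.9).
-/

open MeasureTheory Finset SimpleGraph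
open Literature.Probability.Percolation (BondConfig openConnIn openCrossing explSet explRim explEvent)

universe u

namespace Literature.Probability.LatticeModels

variable {V : Type*} [Fintype V] [DecidableEq V]

/-- **Bounds on an exploration datum of a block.** If `ω ∩ E'` (`E' ⊆ E`) has explored set `U` and
rim `R` for the block `(b₀, b₀M^m)` explored from `inSet b₀` (`b₀M^m ≤ Rmax`, `M ≥ 4`, `m ≥ 1`), then
`inSet b₀ ⊆ U`, the vertices of `U` are good of radius `< b₀M^m`, the rim vertices are good of
radius in `[b₀M^m, b₀M^m + η)` and lie off `U`. [cite: BasuSapozhnikov2017ECP, §2 eq. (2.3)] -/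
theorem ScaleFrame.datum_bounds (F : ScaleFrame V) {b₀ M : ℝ} {m : ℕ} (hb₀ : 0 < b₀) (hM : 4 ≤ M)
    (hm : 1 ≤ m) (hR : b₀ * M ^ m ≤ F.Rmax) {E' : Set (Sym2 V)} (hE' : E' ⊆ ↑F.E) {U R : Set V}
    {ω : BondConfig V} (h : ω ∩ E' ∈ explEvent (F.inSet b₀) (F.annSet b₀ (b₀ * M ^ m)) U R) :
    F.inSet b₀ ⊆ U ∧ (∀ v ∈ U, v ∈ F.good ∧ F.rad v < b₀ * M ^ m) ∧
      (∀ r ∈ R, r ∈ F.good ∧ b₀ * M ^ m ≤ F.rad r ∧ F.rad r < b₀ * M ^ m + F.η) ∧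
        ∀ r ∈ R, r ∉ U := by
  obtain ⟨hU, hRim⟩ := h
  have hb1 : b₀ < b₀ * M ^ m := by
    have h := scale_gap hb₀ hM (Nat.lt_of_lt_of_le Nat.zero_lt_one hm)
    rw [pow_zero, mul_one] at h
    linarith
  have hUb : ∀ v ∈ U, v ∈ F.good ∧ F.rad v < b₀ * M ^ m := by
    intro v hv
    rw [← hU] at hv
    rcases Percolation.explSet_subset _ _ _ hv with ⟨hg, h⟩ | ⟨hg, -, h⟩
    · exact ⟨hg, by linarith⟩
    · exact ⟨hg, h⟩
  refine ⟨hU ▸ Percolation.subset_explSet _ _ _, hUb, fun r hr => ?_, fun r hr hrU => ?_⟩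
  · rw [← hRim] at hr
    have hrIB := Percolation.explRim_disjoint hr
    obtain ⟨-, v, hv, hvr⟩ := Percolation.mem_explRim_iff.1 hr
    rw [hU] at hv
    obtain ⟨hvg, hvr'⟩ := hUb v hv
    obtain ⟨hrg, hrr⟩ := F.adj_good _ (Finset.mem_coe.1 (hE' hvr.2)) v (Sym2.mem_mk_left v r) r
      (Sym2.mem_mk_right v r) hvg (by linarith)
    have h2 := (abs_lt.1 hrr).2
    refine ⟨hrg, ?_, by linarith⟩
    by_contra hlt
    rcases le_or_gt (F.rad r) b₀ with h | h
    · exact hrIB (Or.inl ⟨hrg, h⟩)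
    · exact hrIB (Or.inr ⟨hrg, h, not_le.1 hlt⟩)
  · rw [← hRim] at hr
    rw [← hU] at hrU
    exact (Percolation.mem_explRim_iff.1 hr).1 hrU

/-- **The chain kernel has bounded cross-ratios, given Kesten's Lemma (23).** With the statement of
`ScaleFrame.kernel_crossRatio_le` (Kesten's Lemma (23) / Basu–Sapozhnikov (2.9) for the Off family)
as hypothesis: for inner base `b`, outer base `b' = bM^{m+17+g}` (`b'M^{m+1} ≤ Rmax`, `η ≤ b`, the
RSW ladder of length `m+16+g` at base `b`), the kernel
`N(C, D) = φ(Fd_{b'}(C) ∩ Fd_b(D) ∩ {R_D ↔ R_C in (U_C ∪ R_C) ∖ U_D})` satisfies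
`N(C, D) N(C', D') ≤ (q⁸/c²⁰) N(C, D') N(C', D)` for all outer data `C, C'` and inner data `D, D'`:
an empty datum event kills both sides; otherwise the data are admissible for Lemma (23) with the
contexts `(Fd_{b'}(C), U_C ∪ R_C, R_C)` (`datum_bounds`, `datumOff_iff_of_agree_far`).
[cite: Kesten1986, §2 Lemma (23)] -/
theorem ScaleFrame.kernel_crossRatio_le_of_key
    (hKEY : ∀ {V : Type u} [Fintype V] [DecidableEq V] (F : ScaleFrame V) {p q c a M : ℝ} {m g : ℕ},
      p ∈ Set.Ico (0 : ℝ) 1 → 1 ≤ q → 0 < c → c ≤ 1 → 0 < a → 4 ≤ M → 1 ≤ m → 1 ≤ g →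
      a * M ^ (m + 16 + g) ≤ F.Rmax → F.η ≤ a →
      F.LadderRSWb p q c a M (m + 16 + g) 13 →
    ∀ (U' R' U'' R'' : Set V),
      (∀ v ∈ U', v ∈ F.good ∧ F.rad v < a * M ^ m) →
      (∀ v ∈ R', v ∈ F.good ∧ F.rad v < a * M ^ m + F.η) →
      (∀ v ∈ U'', v ∈ F.good ∧ F.rad v < a * M ^ m) →
      (∀ v ∈ R'', v ∈ F.good ∧ F.rad v < a * M ^ m + F.η) →
    ∀ (Fo Fo' : Set (BondConfig V)) (Wo Wo' R Rq : Set V),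
      (∀ ω₁ ω₂ : BondConfig V, (∀ e ∈ F.E,
        (∀ x ∈ e, x ∈ F.outSet (a * M ^ (m + 16)) (a * M ^ (m + 16 + g))) → (e ∈ ω₁ ↔ e ∈ ω₂)) →
          (ω₁ ∈ Fo ↔ ω₂ ∈ Fo)) →
      (∀ ω₁ ω₂ : BondConfig V, (∀ e ∈ F.E,
        (∀ x ∈ e, x ∈ F.outSet (a * M ^ (m + 16)) (a * M ^ (m + 16 + g))) → (e ∈ ω₁ ↔ e ∈ ω₂)) →
          (ω₁ ∈ Fo' ↔ ω₂ ∈ Fo')) →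
      (∀ v : V, v ∈ F.good → F.rad v < a * M ^ (m + 16 + g) → v ∈ Wo) →
      (∀ v : V, v ∈ F.good → F.rad v < a * M ^ (m + 16 + g) → v ∈ Wo') →
      R ⊆ Wo ∩ F.outSet (a * M ^ (m + 16)) (a * M ^ (m + 16 + g)) →
      Rq ⊆ Wo' ∩ F.outSet (a * M ^ (m + 16)) (a * M ^ (m + 16 + g)) →
      let P := rcMeasure (fromEdgeSet (↑F.E : Set (Sym2 V))) p q ∅
      let Fd : Set V → Set V → Set (BondConfig V) := fun U₀ R₀ =>
        {ω | ω ∩ (↑F.E : Set (Sym2 V)) ∈ explEvent (F.inSet a) (F.annSet a (a * M ^ m)) U₀ R₀ ∩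
          {ω | ∀ r ∈ R₀, ∀ r₂ ∈ R₀, ∃ v ∈ U₀ \ F.inSet a, ∃ v' ∈ U₀ \ F.inSet a,
            s(v, r) ∈ ω ∧ s(v', r₂) ∈ ω ∧ ω ∈ openConnIn (U₀ \ F.inSet a) v v'}}
      let N : Set (BondConfig V) → Set V → Set V → Set V → Set V → ℝ := fun Fo₀ Wo₀ R₀ U₀ R₀' =>
        P.real (Fo₀ ∩ Fd U₀ R₀' ∩ openCrossing (Wo₀ \ U₀) R₀' R₀)
      N Fo Wo R U' R' * N Fo' Wo' Rq U'' R'' ≤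
        q ^ 8 / c ^ 20 * (N Fo Wo R U'' R'' * N Fo' Wo' Rq U' R')) :
    ∀ {V : Type u} [Fintype V] [DecidableEq V] (F : ScaleFrame V) {p q c b b' M : ℝ} {m g : ℕ},
      p ∈ Set.Ico (0 : ℝ) 1 → 1 ≤ q → 0 < c → c ≤ 1 → 0 < b → 4 ≤ M → 1 ≤ m → 1 ≤ g →
      b' = b * M ^ (m + 17 + g) → b' * M ^ (m + 1) ≤ F.Rmax → F.η ≤ b →
      F.LadderRSWb p q c b M (m + 16 + g) 13 →
    ∀ (UC RC UC' RC' UD RD UD' RD' : Set V),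
      let P := rcMeasure (fromEdgeSet (↑F.E : Set (Sym2 V))) p q ∅
      let Fd : ℝ → Set V → Set V → Set (BondConfig V) := fun b₀ U R =>
        {ω | ω ∩ (↑F.E : Set (Sym2 V)) ∈ explEvent (F.inSet b₀) (F.annSet b₀ (b₀ * M ^ m)) U R ∩
          {ω | ∀ r ∈ R, ∀ r₂ ∈ R, ∃ v ∈ U \ F.inSet b₀, ∃ v' ∈ U \ F.inSet b₀,
            s(v, r) ∈ ω ∧ s(v', r₂) ∈ ω ∧ ω ∈ openConnIn (U \ F.inSet b₀) v v'}}
      let N : Set V → Set V → Set V → Set V → ℝ := fun UC RC UD RD =>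
        P.real (Fd b' UC RC ∩ Fd b UD RD ∩ openCrossing ((UC ∪ RC) \ UD) RD RC)
      N UC RC UD RD * N UC' RC' UD' RD' ≤ q ^ 8 / c ^ 20 * (N UC RC UD' RD' * N UC' RC' UD RD) := by
  intro V _ _ F p q c b b' M m g hp hq hc hc1 hb hM hm hg hb' hRmax hη hL UC RC UC' RC' UD RD UD' RD'
    P Fd N
  subst hb'
  have hη0 := F.η_pos
  -- scales
  have hb'0 : 0 < b * M ^ (m + 17 + g) := by positivity
  have hsc1 : b * M ^ (m + 16 + g) + b ≤ b * M ^ (m + 17 + g) := scale_gap hb hM (by omega)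
  have hsc2 : b * M ^ m + b ≤ b * M ^ (m + 16 + g) := scale_gap hb hM (by omega)
  have hsc3 : b * M ^ (m + 17 + g) ≤ b * M ^ (m + 17 + g) * M ^ (m + 1) :=
    le_mul_of_one_le_right hb'0.le (one_le_pow₀ (by linarith))
  have hsc4 : b * M ^ (m + 17 + g) * M ^ m + b * M ^ (m + 17 + g) ≤ F.Rmax :=
    (scale_gap hb'0 hM (Nat.lt_succ_self m)).trans hRmax
  have hsc5 : b * M ^ (m + 17 + g) ≤ b * M ^ (m + 17 + g) * M ^ m :=
    le_mul_of_one_le_right hb'0.le (one_le_pow₀ (by linarith))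
  have hbm : b ≤ b * M ^ m := by
    have h := scale_gap hb hM (Nat.lt_of_lt_of_le Nat.zero_lt_one hm)
    rw [pow_zero, mul_one] at h
    linarith
  have hsc6 : b * M ^ (m + 16) < b * M ^ (m + 16 + g) := by
    have h := scale_gap hb hM (show m + 16 < m + 16 + g by omega)
    linarith
  have hR16 : b * M ^ (m + 16 + g) ≤ F.Rmax := by linarith
  have hRm : b * M ^ m ≤ F.Rmax := by linarith
  have hR'm : b * M ^ (m + 17 + g) * M ^ m ≤ F.Rmax := by linarith
  -- vanishing kernels on empty datum events
  have hN0C : ∀ (UC₀ RC₀ UD₀ RD₀ : Set V), Fd (b * M ^ (m + 17 + g)) UC₀ RC₀ = ∅ →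
      N UC₀ RC₀ UD₀ RD₀ = 0 := fun UC₀ RC₀ UD₀ RD₀ h0 => by
    simp only [N, h0, Set.empty_inter, measureReal_empty]
  have hN0D : ∀ (UC₀ RC₀ UD₀ RD₀ : Set V), Fd b UD₀ RD₀ = ∅ → N UC₀ RC₀ UD₀ RD₀ = 0 :=
    fun UC₀ RC₀ UD₀ RD₀ h0 => by
      simp only [N, h0, Set.inter_empty, Set.empty_inter, measureReal_empty]
  rcases (Fd (b * M ^ (m + 17 + g)) UC RC).eq_empty_or_nonempty with h0 | ⟨ωC, hωC⟩
  · rw [hN0C UC RC UD RD h0, hN0C UC RC UD' RD' h0, zero_mul, zero_mul, mul_zero]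
  rcases (Fd (b * M ^ (m + 17 + g)) UC' RC').eq_empty_or_nonempty with h0 | ⟨ωC', hωC'⟩
  · rw [hN0C UC' RC' UD' RD' h0, hN0C UC' RC' UD RD h0, mul_zero, mul_zero, mul_zero]
  rcases (Fd b UD RD).eq_empty_or_nonempty with h0 | ⟨ωD, hωD⟩
  · rw [hN0D UC RC UD RD h0, hN0D UC' RC' UD RD h0, zero_mul, mul_zero, mul_zero]
  rcases (Fd b UD' RD').eq_empty_or_nonempty with h0 | ⟨ωD', hωD'⟩
  · rw [hN0D UC' RC' UD' RD' h0, hN0D UC RC UD' RD' h0, mul_zero, zero_mul, mul_zero]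
  -- admissibility of the inner data
  obtain ⟨-, hUD, hRD, -⟩ := F.datum_bounds hb hM hm hRm subset_rfl hωD.1
  obtain ⟨-, hUD', hRD', -⟩ := F.datum_bounds hb hM hm hRm subset_rfl hωD'.1
  -- admissibility of the outer contexts
  have hout : ∀ x : V, (x ∈ F.good → b * M ^ (m + 16 + g) ≤ F.rad x) →
      x ∈ F.outSet (b * M ^ (m + 16)) (b * M ^ (m + 16 + g)) :=
    fun x hx => (F.mem_outSet_iff_of_lt hsc6).2 hx
  have hFo : ∀ (UC₀ RC₀ : Set V) (ω₁ ω₂ : BondConfig V), (∀ e ∈ F.E,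
      (∀ x ∈ e, x ∈ F.outSet (b * M ^ (m + 16)) (b * M ^ (m + 16 + g))) → (e ∈ ω₁ ↔ e ∈ ω₂)) →
        (ω₁ ∈ Fd (b * M ^ (m + 17 + g)) UC₀ RC₀ ↔ ω₂ ∈ Fd (b * M ^ (m + 17 + g)) UC₀ RC₀) := by
    intro UC₀ RC₀ ω₁ ω₂ hag
    refine F.datumOff_iff_of_agree_far hb'0 hM hm (by linarith) hR'm subset_rfl fun e he hfar =>
      hag e (Finset.mem_coe.1 he) fun x hx => hout x fun _ => ?_
    have := (hfar x hx).2
    linarith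
  have hctx : ∀ {UC₀ RC₀ : Set V} {ω : BondConfig V}, ω ∈ Fd (b * M ^ (m + 17 + g)) UC₀ RC₀ →
      (∀ v : V, v ∈ F.good → F.rad v < b * M ^ (m + 16 + g) → v ∈ UC₀ ∪ RC₀) ∧
        RC₀ ⊆ (UC₀ ∪ RC₀) ∩ F.outSet (b * M ^ (m + 16)) (b * M ^ (m + 16 + g)) := by
    intro UC₀ RC₀ ω hω
    obtain ⟨hIn, -, hRb, -⟩ := F.datum_bounds hb'0 hM hm hR'm subset_rfl hω.1
    refine ⟨fun v hg hr => Or.inl (hIn ⟨hg, by linarith⟩), fun r hr => ⟨Or.inr hr, hout r fun _ => ?_⟩⟩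
    have := (hRb r hr).2.1
    linarith
  obtain ⟨hWo, hRsub⟩ := hctx hωC
  obtain ⟨hWo', hRsub'⟩ := hctx hωC'
  exact hKEY F hp hq hc hc1 hb hM hm hg hR16 hη hL UD RD UD' RD' hUD
    (fun r hr => ⟨(hRD r hr).1, (hRD r hr).2.2⟩) hUD' (fun r hr => ⟨(hRD' r hr).1, (hRD' r hr).2.2⟩)
    (Fd (b * M ^ (m + 17 + g)) UC RC) (Fd (b * M ^ (m + 17 + g)) UC' RC') (UC ∪ RC) (UC' ∪ RC')
    RC RC' (hFo UC RC) (hFo UC' RC') hWo hWo' hRsub hRsub'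

end Literature.Probability.LatticeModels
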